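import Literature.Computability.AlgebraicComplexity.BurgisserPolyWeightBounds
import HarnessLib

/-!
# Bürgisser's Theorem 4.5 (TCS 2000) from its two geometric ingredients

Trunk T-CPLX-ALG. Bürgisser, *Cook's versus Valiant's hypothesis*, TCS 235 (2000) 71–88,
Thm. 4.5 (p. 82) is the named fact `algebraicSolution_height_bound` of
`BurgisserReductionModPrimes.lean` (a solvable integer system of degree `≤ d`, `n < d` unknowns,
weight `≤ w` has a solution `x_i = λ⁻¹ v_i(y)`, `g(y) = 0`, `g ∈ ℤ[Y]` primitive irreducible,
`deg g, deg v_i ≤ d^{O(n)}`, `log λ, log wt(g), log wt(v_i) ≤ d^{O(n)} log w`). This file proves it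
from the two geometric ingredients of the printed proof, taken as explicit hypotheses stated
exactly as the proof consumes them (p. 82; they are Bézout-inequality and arithmetic-geometry
results not available in Mathlib, to be vendored as the named facts
`zeroDimReduction_small_weight` and `KrickPardo_shapeLemma_height` through the split path of
`algebraicSolution_height_bound`, D-0026):

* (A) Lemmas 4.3–4.4 (p. 82, first paragraph of the proof): "we obtain `n` integer polynomials
  `F_1, …, F_n` satisfying `deg F_i ≤ d`, `wt(F_i) ≤ w d^{2n}`, and such that
  `V := Z(F_1, …, F_n)` is zero-dimensional and contains a solution of the original system" —
  with the tacit `w ≥ 1` made explicit;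
* (B) Krick–Pardo [18, Prop. 27] with Lemma 2.4 (p. 82, second paragraph): a positive integer
  `λ`, an integer linear form `ℓ` and `v_i ∈ ℤ[Y]` with `x_i = λ⁻¹ v_i(ℓ(x))` on `Z(F)`,
  `deg v_i ≤ c d^{cn}`, `log λ, log wt(v_i) ≤ c d^{cn} log W` for any weight bound `W ≥ 2` of the
  `F_i` (the source takes `W = w d^{2n}`; Lemma 2.4 needs constants `≥ 2`),

following p. 82 line by line: `y := ℓ(x)`; the numerators `G_i := λ^d F_i(λ⁻¹ v(Y))`
(`numeratorPoly`) vanish at `y`; if all `v_i` are constant we are done (`g := Y`); otherwise some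
`G_i ≠ 0` (a non-constant `v_j` would give infinitely many points of the finite `Z(F)`), `g` is an
irreducible (hence primitive) factor of `G_i` vanishing at `y`, `deg g ≤ deg G_i ≤ d · max deg v_j`,
`wt(G_i) ≤ wt(F_i) λ^d (max wt v_j)^d`, and Mignotte's bound `wt(g) ≤ 2^{deg G_i} wt(G_i)`
(`polyWeight_le_two_pow_mul_of_dvd`). The bookkeeping constant is `a = 16c + 16`
(`log(w d^{2n}) ≤ 5 d² log w` for `w ≥ 2`, `n < d`). The degenerate cases `n = 0` and `w ≤ 1`
(every equation is `0` or `± a non-constant monomial`, so `x = 0` solves (S); the printed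
argument tacitly assumes `w ≥ 2`) are settled directly with `λ = 1`, `v = 0`, `g = Y`, `y = 0`.

What is NOT here: proofs of (A) and (B) (Bézout's inequality / degree of affine varieties and
the heights of geometric resolutions are not in Mathlib); hence this file yields
`algebraicSolution_height_bound_of_ingredients`, not yet `algebraicSolution_height_bound_holds`.
The elementary ingredients (weights, Mignotte, numerator polynomials) are in
`BurgisserPolyWeightBounds.lean`.

## References
* [Burgisser2000TCS] P. Bürgisser, Cook's versus Valiant's hypothesis, TCS 235 (2000) 71–88,
  Thm. 4.5 and its proof, p. 82–83.
-/

noncomputable section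

open scoped Classical
open MvPolynomial Literature.Computability.Complexity Literature.Computability.AlgebraicComplexity

namespace Literature.Computability.AlgebraicComplexity

section Assembly45

variable {n s : ℕ}

/-- The shape of the conclusion of Thm. 4.5 when all `v_j` are constant: take `g = Y`, `y = 0`
(Bürgisser 2000 TCS, p. 82: "otherwise all `v_i` are constant, and we are done already").
`A ≥ 1` and `B ≥ 0` are the degree and height budgets. [cite: Burgisser2000TCS, proof of Thm. 4.5 p. 82] -/
theorem thm45_of_const (S : Fin s → MvPolynomial (Fin n) ℤ) {lam : ℕ} (hlam : 0 < lam)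
    (v : Fin n → Polynomial ℤ) (hv : ∀ j, (v j).natDegree = 0)
    (hsol : ∀ i, aeval (fun j => (lam : ℂ)⁻¹ * Polynomial.aeval (0 : ℂ) (v j)) (S i) = 0)
    {A B : ℝ} (hA : 1 ≤ A) (hB : 0 ≤ B) (hlamB : Real.log lam ≤ B)
    (hvB : ∀ j, Real.log (polyWeight (v j)) ≤ B) :
    ∃ (lam : ℕ) (v : Fin n → Polynomial ℤ) (g : Polynomial ℤ) (y : ℂ),
      0 < lam ∧ Irreducible g ∧ g.IsPrimitive ∧ 0 < g.natDegree ∧ Polynomial.aeval y g = 0 ∧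
      (∀ i, aeval (fun j => (lam : ℂ)⁻¹ * Polynomial.aeval y (v j)) (S i) = 0) ∧
      (g.natDegree : ℝ) ≤ A ∧ (∀ j, ((v j).natDegree : ℝ) ≤ A) ∧
      Real.log lam ≤ B ∧ Real.log (polyWeight g) ≤ B ∧
      ∀ j, Real.log (polyWeight (v j)) ≤ B := by
  refine ⟨lam, v, Polynomial.X, 0, hlam, Polynomial.irreducible_X, Polynomial.monic_X.isPrimitive,
    by simp, by simp, hsol, by simpa using hA, fun j => ?_, hlamB, by simp [hB], hvB⟩
  rw [hv j, Nat.cast_zero]; linarith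

/-- The conclusion of Thm. 4.5 for a system solved by `x = 0`: `λ = 1`, `v = 0`, `g = Y`, `y = 0`.
[cite: Burgisser2000TCS, proof of Thm. 4.5 p. 82] -/
theorem thm45_of_zero_solution (S : Fin s → MvPolynomial (Fin n) ℤ)
    (h0 : ∀ i, aeval (0 : Fin n → ℂ) (S i) = 0) {A B : ℝ} (hA : 1 ≤ A) (hB : 0 ≤ B) :
    ∃ (lam : ℕ) (v : Fin n → Polynomial ℤ) (g : Polynomial ℤ) (y : ℂ),
      0 < lam ∧ Irreducible g ∧ g.IsPrimitive ∧ 0 < g.natDegree ∧ Polynomial.aeval y g = 0 ∧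
      (∀ i, aeval (fun j => (lam : ℂ)⁻¹ * Polynomial.aeval y (v j)) (S i) = 0) ∧
      (g.natDegree : ℝ) ≤ A ∧ (∀ j, ((v j).natDegree : ℝ) ≤ A) ∧
      Real.log lam ≤ B ∧ Real.log (polyWeight g) ≤ B ∧
      ∀ j, Real.log (polyWeight (v j)) ≤ B := by
  refine thm45_of_const S Nat.one_pos (fun _ => 0) (fun _ => Polynomial.natDegree_zero) ?_ hA hB
    (by simp [hB]) (fun _ => by simp [hB])
  intro i
  have : (fun j : Fin n => (((1 : ℕ) : ℂ))⁻¹ * Polynomial.aeval (0 : ℂ) (0 : Polynomial ℤ)) = 0 := by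
    funext j; simp
  rw [this]; exact h0 i

/-- A polynomial of weight `≤ 1` is `0` or `±` a monomial; if it has a complex zero, the
monomial is non-constant, so the polynomial vanishes at the origin (the case `w ≤ 1` of
Thm. 4.5, tacitly excluded in the printed proof). [folklore] -/
theorem aeval_zero_of_weight_le_one {f : MvPolynomial (Fin n) ℤ} (hw : weight f ≤ 1)
    {z : Fin n → ℂ} (hz : aeval z f = 0) : aeval (0 : Fin n → ℂ) f = 0 := by
  rw [MvPolynomial.aeval_zero, algebraMap_int_eq, eq_intCast, Int.cast_eq_zero]
  by_contra hne
  have h0mem : (0 : Fin n →₀ ℕ) ∈ f.support := by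
    rwa [MvPolynomial.mem_support_iff, ← MvPolynomial.constantCoeff_eq]
  have hsplit := Finset.add_sum_erase f.support (fun m => (f.coeff m).natAbs) h0mem
  have h1 : 1 ≤ (f.coeff 0).natAbs := Int.natAbs_pos.2 (by rwa [← MvPolynomial.constantCoeff_eq])
  have hrest : ∑ m ∈ f.support.erase 0, (f.coeff m).natAbs = 0 := by
    have : weight f = (f.coeff 0).natAbs + ∑ m ∈ f.support.erase 0, (f.coeff m).natAbs :=
      hsplit.symm
    omega
  have hcoeff : ∀ m, m ≠ 0 → f.coeff m = 0 := by
    intro m hm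
    by_cases hms : m ∈ f.support
    · have := Finset.sum_eq_zero_iff.1 hrest m (Finset.mem_erase.2 ⟨hm, hms⟩)
      exact Int.natAbs_eq_zero.1 this
    · exact MvPolynomial.notMem_support_iff.1 hms
  have hfC : f = MvPolynomial.C (f.coeff 0) := by
    ext m
    rw [MvPolynomial.coeff_C]
    split_ifs with hm
    · rw [← hm]
    · exact hcoeff m (Ne.symm hm)
  rw [hfC, MvPolynomial.aeval_C, algebraMap_int_eq, eq_intCast, Int.cast_eq_zero] at hz
  exact hne (by rwa [MvPolynomial.constantCoeff_eq])

/-- **Theorem 4.5 from its two geometric ingredients** (Bürgisser 2000 TCS, p. 82): the named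
fact `algebraicSolution_height_bound` (algebraic solutions of small degree and height) follows
from
* `hA` — Lemmas 4.3–4.4 as combined on p. 82: "By Lemma 4.4, we can add to the system (S)
  suitable linear equations of weight at most `dⁿ`, such that the resulting system becomes
  zero-dimensional. By Lemma 4.3, we obtain `n` integer polynomials `F_1, …, F_n` satisfying
  `deg F_i ≤ d`, `wt(F_i) ≤ w d^{2n}`, and such that `V := Z(F_1, …, F_n)` is zero-dimensional and
  contains a solution of the original system (S)" (for (S) of degree `≤ d`, `n < d`, weight
  `≤ w`, `w ≥ 1`, solvable over `ℂ`; zero-dimensional = finite complex zero set), and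
* `hB` — Krick–Pardo [18, Prop. 27] with Lemma 2.4 as combined on p. 82: for `F_1, …, F_n` of
  degree `≤ d`, `n < d`, weight `≤ W`, `W ≥ 2`, with finite zero set, "the existence of an integer
  linear form `ℓ`, of a positive integer `λ`, and of univariate integer polynomials
  `v_i ∈ ℤ[Y]` such that … `x_i = λ⁻¹ v_i(ℓ(x))` for all `x ∈ V` … we conclude with Lemma 2.4
  that `deg v_i = d^{O(n)}`, `max{log λ, log wt(v_i)} = d^{O(n)} log W`" (`d^{O(n)}` as `c d^{cn}`),
by the remaining, elementary steps of the printed proof, all proved here and in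
`BurgisserPolyWeightBounds.lean`: the numerators `G_i`, the primitive irreducible factor `g` of
`G_i ≠ 0` vanishing at `y = ℓ(x)`, `deg G_i ≤ d · max deg v_j`,
`wt(G_i) ≤ wt(F_i) λ^d (max wt v_j)^d`, Mignotte's bound; constant `a = 16c + 16`. The two
hypotheses are the statements reserved for the named facts `zeroDimReduction_small_weight` and
`KrickPardo_shapeLemma_height` (split path of `algebraicSolution_height_bound`); with those
discharged this theorem yields `algebraicSolution_height_bound_holds`. [cite: Burgisser2000TCS, Thm. 4.5 and its proof p. 82] -/
theorem algebraicSolution_height_bound_of_ingredients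
    (hA : ∀ (n s d w : ℕ) (S : Fin s → MvPolynomial (Fin n) ℤ),
      n < d → 1 ≤ w → (∀ i, (S i).totalDegree ≤ d) → (∀ i, weight (S i) ≤ w) →
      (∃ z : Fin n → ℂ, ∀ i, aeval z (S i) = 0) →
      ∃ F : Fin n → MvPolynomial (Fin n) ℤ,
        (∀ i, (F i).totalDegree ≤ d) ∧ (∀ i, weight (F i) ≤ w * d ^ (2 * n)) ∧
        {z : Fin n → ℂ | ∀ i, aeval z (F i) = 0}.Finite ∧
        ∃ z : Fin n → ℂ, (∀ i, aeval z (F i) = 0) ∧ ∀ i, aeval z (S i) = 0)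
    (hB : ∃ c : ℕ, ∀ (n d W : ℕ) (F : Fin n → MvPolynomial (Fin n) ℤ),
      n < d → 2 ≤ W → (∀ i, (F i).totalDegree ≤ d) → (∀ i, weight (F i) ≤ W) →
      {z : Fin n → ℂ | ∀ i, aeval z (F i) = 0}.Finite →
      ∃ (ℓ : Fin n → ℤ) (lam : ℕ) (v : Fin n → Polynomial ℤ), 0 < lam ∧
        (∀ z : Fin n → ℂ, (∀ i, aeval z (F i) = 0) →
          ∀ j, z j = (lam : ℂ)⁻¹ * Polynomial.aeval (∑ k, (ℓ k : ℂ) * z k) (v j)) ∧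
        (∀ j, (v j).natDegree ≤ c * d ^ (c * n)) ∧
        Real.log lam ≤ c * (d : ℝ) ^ (c * n) * Real.log W ∧
        ∀ j, Real.log (polyWeight (v j)) ≤ c * (d : ℝ) ^ (c * n) * Real.log W) :
    algebraicSolution_height_bound := by
  obtain ⟨c, hB⟩ := hB
  refine ⟨16 * c + 16, ?_⟩
  intro n s d w S hnd hdeg hwt hsol
  have hd1 : 1 ≤ d := by omega
  -- the budgets `T = a d^{an}` and `T log w`
  set D : ℝ := (d : ℝ) with hDdef
  have hD1 : (1 : ℝ) ≤ D := by rw [hDdef]; exact_mod_cast hd1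
  set P : ℝ := D ^ ((16 * c + 16) * n) with hPdef
  have hP1 : 1 ≤ P := one_le_pow₀ hD1
  have hc0 : (0 : ℝ) ≤ c := Nat.cast_nonneg c
  have hcP : (0 : ℝ) ≤ c * P := by positivity
  set T : ℝ := ((16 * c + 16 : ℕ) : ℝ) * D ^ ((16 * c + 16) * n) with hTdef
  have hTP : T = (16 * c + 16 : ℝ) * P := by rw [hTdef]; push_cast; ring
  have hT1 : 1 ≤ T := by rw [hTP]; linarith
  set lw : ℝ := Real.log (w : ℝ) with hlwdef
  have hlw0 : 0 ≤ lw := Real.log_natCast_nonneg w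
  have hTB : 0 ≤ T * lw := mul_nonneg (by linarith) hlw0
  -- degenerate case `n = 0`
  rcases Nat.eq_zero_or_pos n with rfl | hn
  · obtain ⟨z, hz⟩ := hsol
    refine thm45_of_zero_solution S (fun i => ?_) hT1 hTB
    convert hz i
  -- degenerate case `w ≤ 1`: `x = 0` solves (S)
  by_cases hw : w ≤ 1
  · obtain ⟨z, hz⟩ := hsol
    exact thm45_of_zero_solution S
      (fun i => aeval_zero_of_weight_le_one ((hwt i).trans hw) (hz i)) hT1 hTB
  have hw2 : 2 ≤ w := by omega
  have hd2 : 2 ≤ d := by omega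
  have hD2 : (2 : ℝ) ≤ D := by rw [hDdef]; exact_mod_cast hd2
  have hlw2 : Real.log 2 ≤ lw := Real.log_le_log two_pos (by exact_mod_cast hw2)
  have hlwhalf : (1 : ℝ) / 2 < lw := lt_of_lt_of_le (by have := Real.log_two_gt_d9; linarith) hlw2
  -- (A): `n` equations with finite zero set
  obtain ⟨F, hFdeg, hFwt, hfin, z, hzF, hzS⟩ := hA n s d w S hnd (by omega) hdeg hwt hsol
  -- (B) with `W = w d^{2n}`
  have hW2 : 2 ≤ w * d ^ (2 * n) :=
    le_trans hw2 (Nat.le_mul_of_pos_right _ (pow_pos (by omega) _))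
  obtain ⟨ℓ, lam, v, hlam, hshape, hvdeg, hloglam, hlogv⟩ :=
    hB n d (w * d ^ (2 * n)) F hnd hW2 hFdeg hFwt hfin
  set y : ℂ := ∑ k, (ℓ k : ℂ) * z k with hydef
  have hzj : ∀ j, z j = (lam : ℂ)⁻¹ * Polynomial.aeval y (v j) := hshape z hzF
  have hzfun : (fun j => (lam : ℂ)⁻¹ * Polynomial.aeval y (v j)) = z := (funext hzj).symm
  have hne : (lam : ℂ) ≠ 0 := by exact_mod_cast hlam.ne'
  -- bookkeeping: `E = d^{cn}`, `L = log(w d^{2n}) ≤ 5 d² log w`, `E d^k ≤ P` (`k ≤ 3`)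
  set E : ℝ := D ^ (c * n) with hEdef
  have hE0 : 0 ≤ E := by positivity
  set L : ℝ := Real.log ((w * d ^ (2 * n) : ℕ) : ℝ) with hLdef
  have hL0 : 0 ≤ L := Real.log_natCast_nonneg _
  have hL : L ≤ 5 * D ^ 2 * lw := by
    have hsplit : L = lw + 2 * n * Real.log D := by
      rw [hLdef, hlwdef, hDdef]; push_cast
      rw [Real.log_mul (by positivity) (by positivity), Real.log_pow]; push_cast; ring
    have hlogD : Real.log D ≤ D := (Real.log_le_sub_one_of_pos (by positivity)).trans (by linarith)
    have hnD : (n : ℝ) ≤ D := by rw [hDdef]; exact_mod_cast hnd.le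
    have h1 : (n : ℝ) * Real.log D ≤ D * D :=
      mul_le_mul hnD hlogD (Real.log_nonneg hD1) (by positivity)
    have h2 : 0 ≤ D ^ 2 * (2 * lw - 1) := mul_nonneg (by positivity) (by linarith)
    have h3 : lw ≤ D ^ 2 * lw := le_mul_of_one_le_left hlw0 (one_le_pow₀ hD1)
    rw [hsplit]; linarith
  have hpow : ∀ k, k ≤ 3 → E * D ^ k ≤ P := fun k hk => by
    rw [hEdef, hPdef, ← pow_add]
    refine pow_le_pow_right₀ hD1 ?_
    have hsplit : (16 * c + 16) * n = c * n + (15 * c * n + 16 * n) := by ring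
    rw [hsplit]
    exact Nat.add_le_add_left ((hk.trans (by omega : 3 ≤ 16 * n)).trans (Nat.le_add_left _ _)) _
  have hE1 : 1 ≤ E := one_le_pow₀ hD1
  have hP0 : E ≤ P := by simpa using hpow 0 (by norm_num)
  have hP1' : E * D ≤ P := by simpa using hpow 1 (by norm_num)
  have hP2 : E * D ^ 2 ≤ P := hpow 2 (by norm_num)
  have hP3 : E * D ^ 3 ≤ P := hpow 3 le_rfl
  have hD2P : D ^ 2 ≤ P := le_trans (le_mul_of_one_le_left (by positivity) hE1) hP2
  have hPlw : 0 ≤ P * lw := by positivity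
  have hcPlw : 0 ≤ (c : ℝ) * P * lw := by positivity
  -- the common height bound `c E L ≤ T log w`
  have hcEL : (c : ℝ) * E * L ≤ T * lw := by
    have k1 : (c : ℝ) * E * L ≤ (c : ℝ) * E * (5 * D ^ 2 * lw) :=
      mul_le_mul_of_nonneg_left hL (mul_nonneg hc0 hE0)
    have k2 : (c : ℝ) * (E * D ^ 2) * lw ≤ (c : ℝ) * P * lw :=
      mul_le_mul_of_nonneg_right (mul_le_mul_of_nonneg_left hP2 hc0) hlw0
    rw [hTP]; linarith
  have hcE : (c : ℝ) * E ≤ T := by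
    have k1 : (c : ℝ) * E ≤ (c : ℝ) * P := mul_le_mul_of_nonneg_left hP0 hc0
    rw [hTP]; linarith
  -- case: all `v_j` constant ("we are done already")
  by_cases hconst : ∀ j, (v j).natDegree = 0
  · refine thm45_of_const S hlam v hconst (fun i => ?_) hT1 hTB (hloglam.trans hcEL)
      (fun j => (hlogv j).trans hcEL)
    have : (fun j => (lam : ℂ)⁻¹ * Polynomial.aeval (0 : ℂ) (v j)) = z := by
      funext j
      rw [hzj j, Polynomial.eq_C_of_natDegree_eq_zero (hconst j)]
      simp
    rw [this]; exact hzS i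
  push Not at hconst
  obtain ⟨j₀, hj₀⟩ := hconst
  -- some numerator `G_i = λ^d F_i(λ⁻¹ v(Y))` is nonzero, since `Z(F)` is finite
  have hG : ∃ i, numeratorPoly (F i) d lam v ≠ 0 := by
    by_contra hall
    push Not at hall
    apply hj₀
    apply natDegree_eq_zero_of_finite_range
    have hsub : (Set.range fun t : ℂ => Polynomial.aeval t (v j₀)) ⊆
        (fun x : Fin n → ℂ => (lam : ℂ) * x j₀) '' {x | ∀ i, aeval x (F i) = 0} := by
      rintro _ ⟨t, rfl⟩
      refine ⟨fun j => (lam : ℂ)⁻¹ * Polynomial.aeval t (v j), fun i => ?_, ?_⟩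
      · have h0 := aeval_numeratorPoly (F i) (hFdeg i) (lam := (lam : ℤ)) (Units.mk0 (lam : ℂ) hne)
          (by simp) v t
        rw [hall i, map_zero] at h0
        simp only [Units.val_inv_eq_inv_val, Units.val_mk0, Int.cast_natCast] at h0
        exact (mul_eq_zero.1 h0.symm).resolve_left (pow_ne_zero _ hne)
      · simp only
        rw [← mul_assoc, mul_inv_cancel₀ hne, one_mul]
    exact (hfin.image _).subset hsub
  obtain ⟨i₀, hG0⟩ := hG
  set G := numeratorPoly (F i₀) d lam v with hGdef
  have hGy : Polynomial.aeval y G = 0 :=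
    aeval_numeratorPoly_eq_zero (F i₀) (hFdeg i₀) hlam v (by rw [hzfun]; exact hzF i₀)
  -- `g`: an irreducible primitive factor of `G` vanishing at `y`
  obtain ⟨g, hgirr, hgG, hgy⟩ := exists_irreducible_factor_of_aeval_eq_zero hG0 hGy
  obtain ⟨hgdeg, hgprim⟩ := natDegree_pos_and_isPrimitive_of_irreducible_of_aeval_eq_zero hgirr hgy
  refine ⟨lam, v, g, y, hlam, hgirr, hgprim, hgdeg, hgy, by rw [hzfun]; exact hzS, ?_, ?_,
    hloglam.trans hcEL, ?_, fun j => (hlogv j).trans hcEL⟩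
  · -- `deg g ≤ deg G ≤ d · c d^{cn} ≤ T`
    have h1 : g.natDegree ≤ d * (c * d ^ (c * n)) :=
      (Polynomial.natDegree_le_of_dvd hgG hG0).trans
        (natDegree_numeratorPoly_le (F i₀) (hFdeg i₀) lam v hvdeg)
    have h2 : (g.natDegree : ℝ) ≤ (c : ℝ) * (E * D) := by
      have : ((d * (c * d ^ (c * n)) : ℕ) : ℝ) = (c : ℝ) * (E * D) := by
        rw [hEdef, hDdef]; push_cast; ring
      rw [← this]; exact_mod_cast h1
    have h3 : (c : ℝ) * (E * D) ≤ (c : ℝ) * P := mul_le_mul_of_nonneg_left hP1' hc0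
    rw [hTP]; linarith
  · -- `deg v_j ≤ c d^{cn} ≤ T`
    intro j
    have h2 : ((v j).natDegree : ℝ) ≤ (c : ℝ) * E := by
      have : ((c * d ^ (c * n) : ℕ) : ℝ) = (c : ℝ) * E := by rw [hEdef, hDdef]; push_cast; ring
      rw [← this]; exact_mod_cast hvdeg j
    exact h2.trans hcE
  · -- `log wt(g) ≤ deg G log 2 + log wt(G)` (Mignotte) and `wt(G) ≤ wt(F) λ^d M^d`
    set M : ℕ := max 1 (Finset.univ.sup fun j => polyWeight (v j)) with hMdef
    have hM1 : 1 ≤ M := le_max_left _ _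
    have hMj : ∀ j, polyWeight (v j) ≤ M := fun j =>
      le_max_of_le_right (Finset.le_sup (f := fun j => polyWeight (v j)) (Finset.mem_univ j))
    have hlogM : Real.log M ≤ (c : ℝ) * E * L := by
      rcases max_choice 1 (Finset.univ.sup fun j => polyWeight (v j)) with h | h
      · rw [hMdef, h, Nat.cast_one, Real.log_one]; positivity
      · obtain ⟨j, -, hj⟩ := Finset.exists_mem_eq_sup _
          (Finset.univ_nonempty_iff.2 ⟨⟨0, hn⟩⟩) (fun j => polyWeight (v j))
        rw [hMdef, h, hj]; exact hlogv j
    have hGwt : polyWeight G ≤ weight (F i₀) * lam ^ d * M ^ d :=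
      polyWeight_numeratorPoly_le (F i₀) (hFdeg i₀) hlam v hM1 hMj
    have hGwt1 : 1 ≤ polyWeight G := one_le_polyWeight hG0
    have hFwt1 : 1 ≤ weight (F i₀) := by
      by_contra h0
      rw [not_le, Nat.lt_one_iff] at h0
      rw [h0, zero_mul, zero_mul] at hGwt
      omega
    have hlogF : Real.log (weight (F i₀)) ≤ L :=
      Real.log_le_log (by exact_mod_cast hFwt1) (by exact_mod_cast hFwt i₀)
    have hlogG : Real.log (polyWeight G) ≤ L + 2 * (D * ((c : ℝ) * E * L)) := by
      have hcast : (polyWeight G : ℝ) ≤ (weight (F i₀) : ℝ) * (lam : ℝ) ^ d * (M : ℝ) ^ d := by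
        exact_mod_cast hGwt
      have hFpos : (0 : ℝ) < weight (F i₀) := by exact_mod_cast hFwt1
      have hlampos : (0 : ℝ) < lam := by exact_mod_cast hlam
      have hMpos : (0 : ℝ) < M := by exact_mod_cast hM1
      calc Real.log (polyWeight G)
          ≤ Real.log ((weight (F i₀) : ℝ) * (lam : ℝ) ^ d * (M : ℝ) ^ d) :=
            Real.log_le_log (by exact_mod_cast hGwt1) hcast
        _ = Real.log (weight (F i₀)) + d * Real.log lam + d * Real.log M := by
            rw [Real.log_mul (by positivity) (by positivity), Real.log_mul hFpos.ne' (by positivity),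
              Real.log_pow, Real.log_pow]
        _ ≤ L + D * ((c : ℝ) * E * L) + D * ((c : ℝ) * E * L) := by
            have h2 : (d : ℝ) * Real.log lam ≤ D * ((c : ℝ) * E * L) :=
              mul_le_mul_of_nonneg_left hloglam (by positivity)
            have h3 : (d : ℝ) * Real.log M ≤ D * ((c : ℝ) * E * L) :=
              mul_le_mul_of_nonneg_left hlogM (by positivity)
            linarith
        _ = L + 2 * (D * ((c : ℝ) * E * L)) := by ring
    have hlogg : Real.log (polyWeight g) ≤ G.natDegree * Real.log 2 + Real.log (polyWeight G) := by
      have h := polyWeight_le_two_pow_mul_of_dvd hG0 hgG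
      have hpos : (0 : ℝ) < polyWeight g := by exact_mod_cast one_le_polyWeight hgirr.ne_zero
      have hGpos : (0 : ℝ) < polyWeight G := by exact_mod_cast hGwt1
      calc Real.log (polyWeight g) ≤ Real.log (2 ^ G.natDegree * polyWeight G) :=
            Real.log_le_log hpos h
        _ = G.natDegree * Real.log 2 + Real.log (polyWeight G) := by
            rw [Real.log_mul (by positivity) hGpos.ne', Real.log_pow]
    -- `deg G log 2 ≤ c (E D) log w`
    have hGdeg : G.natDegree ≤ d * (c * d ^ (c * n)) :=
      natDegree_numeratorPoly_le (F i₀) (hFdeg i₀) lam v hvdeg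
    have m1 : (G.natDegree : ℝ) * Real.log 2 ≤ (c : ℝ) * (E * D) * lw := by
      have hcast : (G.natDegree : ℝ) ≤ (c : ℝ) * (E * D) := by
        have : ((d * (c * d ^ (c * n)) : ℕ) : ℝ) = (c : ℝ) * (E * D) := by
          rw [hEdef, hDdef]; push_cast; ring
        rw [← this]; exact_mod_cast hGdeg
      exact mul_le_mul hcast hlw2 (Real.log_nonneg one_le_two) (by positivity)
    have m2 : (c : ℝ) * (E * D) * lw ≤ (c : ℝ) * P * lw :=
      mul_le_mul_of_nonneg_right (mul_le_mul_of_nonneg_left hP1' hc0) hlw0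
    have m3 : D * ((c : ℝ) * E * L) ≤ D * ((c : ℝ) * E * (5 * D ^ 2 * lw)) :=
      mul_le_mul_of_nonneg_left (mul_le_mul_of_nonneg_left hL (mul_nonneg hc0 hE0)) (by positivity)
    have m4 : (c : ℝ) * (E * D ^ 3) * lw ≤ (c : ℝ) * P * lw :=
      mul_le_mul_of_nonneg_right (mul_le_mul_of_nonneg_left hP3 hc0) hlw0
    have m5 : D ^ 2 * lw ≤ P * lw := mul_le_mul_of_nonneg_right hD2P hlw0
    rw [hTP]; linarith

end Assembly45

end Literature.Computability.AlgebraicComplexity
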